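import Summits.RiemannHypothesis.RiemannHypothesis.Theses.IntegerScrew
import HarnessLib

/-!
# Route IntegerScrew — `ScrewDensityDetection` (item stmt-RiemannHypothesis-15760; stub S2 of the lines
`landau_gonek_floor` / `weil_comb_floor` of crux `ScrewPolyFloor`, stmt-RiemannHypothesis-15757)

DENSITY DETECTION: if Suzuki's kernel `G(t,u) = Ψ(t) + Ψ(u) − Ψ(t − u)` has non-negative real
quadratic forms on every finite configuration of LOGARITHMS OF POSITIVE INTEGERS, then it has
non-negative forms on every finite REAL configuration.

Proof (elementary):
* (augmentation identity) for any configuration `t : Fin N → ℝ`, coefficients `x` and any shift `L`,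
  `Σᵢⱼ G(tᵢ,tⱼ) xᵢ xⱼ = Σᵢⱼ G(t'ᵢ,t'ⱼ) yᵢ yⱼ` with the `(N+1)`-point configuration
  `t' = (L, t₁ + L, …, t_N + L)` and `y = (−Σ x, x₁, …, x_N)` — because `Ψ` is even with `Ψ(0) = 0`,
  both sides equal `2 (Σ x)(Σᵢ Ψ(tᵢ) xᵢ) − Σᵢⱼ Ψ(tᵢ − tⱼ) xᵢ xⱼ` (the conditionally negative
  definite form of `−Ψ`, which is translation invariant, on the augmented zero-sum vector);
* (rationals ↦ integers) if every `tᵢ = log mᵢ − log nᵢ` with positive integers, take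
  `L = log ∏ nᵢ`: then `t'` is a configuration of logarithms of positive integers, so the form is `≥ 0`;
* (density) `{log m − log n}` is dense in `ℝ`, the form is continuous in `t` (`continuous_zetaScrew`),
  and a closed set containing a dense set is everything.

Unconditional; axioms propext / Classical.choice / Quot.sound.
-/

-- `Summit.RiemannHypothesis.RiemannHypothesis.…` duplicates `RiemannHypothesis` BY DESIGN (D-0017).
set_option linter.dupNamespace false

noncomputable section

namespace Summit.RiemannHypothesis.RiemannHypothesis.Theorems

open Literature.NumberTheory.LFunctions
open scoped BigOperators
open Finset

namespace IntegerScrew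

/-- The screw quadratic form expanded through `G(t,u) = Ψ(t) + Ψ(u) − Ψ(t−u)`:
`Σᵢⱼ G(tᵢ,tⱼ) xᵢ xⱼ = 2 (Σ x)(Σᵢ Ψ(tᵢ) xᵢ) − Σᵢⱼ Ψ(tᵢ − tⱼ) xᵢ xⱼ`. -/
theorem screwForm_expand {N : ℕ} (t x : Fin N → ℝ) :
    ∑ i, ∑ j, zetaScrewKernel (t i) (t j) * (x i * x j) =
      2 * (∑ i, x i) * (∑ i, zetaScrew (t i) * x i) -
        ∑ i, ∑ j, zetaScrew (t i - t j) * (x i * x j) := by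
  have h1 : ∀ i j, zetaScrewKernel (t i) (t j) * (x i * x j) =
      zetaScrew (t i) * x i * x j + zetaScrew (t j) * x j * x i -
        zetaScrew (t i - t j) * (x i * x j) := by
    intro i j
    rw [zetaScrewKernel_def]
    ring
  simp only [h1, Finset.sum_sub_distrib, Finset.sum_add_distrib]
  have h2 : ∑ i, ∑ j, zetaScrew (t i) * x i * x j = (∑ i, zetaScrew (t i) * x i) * ∑ j, x j := by
    rw [Finset.sum_mul]
    refine Finset.sum_congr rfl fun i _ => ?_
    rw [Finset.mul_sum]
  have h3 : ∑ i, ∑ j, zetaScrew (t j) * x j * x i = (∑ j, zetaScrew (t j) * x j) * ∑ i, x i := by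
    rw [Finset.sum_comm, Finset.sum_mul]
    refine Finset.sum_congr rfl fun j _ => ?_
    rw [Finset.mul_sum]
  rw [h2, h3]
  ring

/-- The `Ψ`-form `Σᵢⱼ Ψ(sᵢ − sⱼ) yᵢ yⱼ` of the augmented configuration `s = (L, t + L)`,
`y = (−Σ x, x)`: it equals `−2 (Σ x)(Σᵢ Ψ(tᵢ) xᵢ) + Σᵢⱼ Ψ(tᵢ − tⱼ) xᵢ xⱼ` (`Ψ` even, `Ψ(0) = 0`). -/
theorem psiForm_cons {N : ℕ} (t x : Fin N → ℝ) (L : ℝ) :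
    ∑ i : Fin (N + 1), ∑ j : Fin (N + 1),
        zetaScrew ((Fin.cons L (fun k => t k + L) : Fin (N + 1) → ℝ) i -
            (Fin.cons L (fun k => t k + L) : Fin (N + 1) → ℝ) j) *
          ((Fin.cons (-∑ k, x k) x : Fin (N + 1) → ℝ) i *
            (Fin.cons (-∑ k, x k) x : Fin (N + 1) → ℝ) j) =
      -(2 * (∑ i, x i) * (∑ i, zetaScrew (t i) * x i)) +
        ∑ i, ∑ j, zetaScrew (t i - t j) * (x i * x j) := by
  simp only [Fin.sum_univ_succ, Fin.cons_zero, Fin.cons_succ, sub_self, zetaScrew_zero, zero_mul,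
    zero_add]
  have e1 : ∀ j, L - (t j + L) = -t j := fun j => by ring
  have e3 : ∀ i j, t i + L - (t j + L) = t i - t j := fun i j => by ring
  have e2 : ∀ i, t i + L - L = t i := fun i => by ring
  simp only [e1, e2, e3, zetaScrew_neg, Finset.sum_add_distrib]
  have h4 : ∑ j, zetaScrew (t j) * (-(∑ k, x k) * x j) =
      -(∑ k, x k) * ∑ j, zetaScrew (t j) * x j := by
    rw [Finset.mul_sum]
    refine Finset.sum_congr rfl fun j _ => ?_
    ring
  have h5 : ∑ i, zetaScrew (t i) * (x i * -(∑ k, x k)) =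
      -(∑ k, x k) * ∑ i, zetaScrew (t i) * x i := by
    rw [Finset.mul_sum]
    refine Finset.sum_congr rfl fun i _ => ?_
    ring
  rw [h4, h5]
  ring

/-- AUGMENTATION IDENTITY: the screw form of `(t, x)` equals the screw form of the shifted,
augmented configuration `t' = (L, t₁ + L, …, t_N + L)` with the zero-sum vector `y = (−Σ x, x)`,
for every shift `L`. -/
theorem screwForm_eq_cons_shift {N : ℕ} (t x : Fin N → ℝ) (L : ℝ) :
    ∑ i, ∑ j, zetaScrewKernel (t i) (t j) * (x i * x j) =
      ∑ i : Fin (N + 1), ∑ j : Fin (N + 1),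
        zetaScrewKernel ((Fin.cons L (fun k => t k + L) : Fin (N + 1) → ℝ) i)
            ((Fin.cons L (fun k => t k + L) : Fin (N + 1) → ℝ) j) *
          ((Fin.cons (-∑ k, x k) x : Fin (N + 1) → ℝ) i *
            (Fin.cons (-∑ k, x k) x : Fin (N + 1) → ℝ) j) := by
  rw [screwForm_expand, screwForm_expand, psiForm_cons]
  have hy : ∑ i : Fin (N + 1), (Fin.cons (-∑ k, x k) x : Fin (N + 1) → ℝ) i = 0 := by
    rw [Fin.sum_univ_succ]
    simp only [Fin.cons_zero, Fin.cons_succ]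
    ring
  rw [hy]
  ring

/-- `log ℚ_{>0} = {log m − log n : m, n ≥ 1}` is dense in `ℝ`. -/
theorem dense_logRatSet :
    Dense {u : ℝ | ∃ m n : ℕ, 1 ≤ m ∧ 1 ≤ n ∧ u = Real.log m - Real.log n} := by
  intro u
  rw [Metric.mem_closure_iff]
  intro ε hε
  have hcont : ContinuousAt Real.log (Real.exp u) :=
    Real.continuousAt_log (Real.exp_pos u).ne'
  rw [Metric.continuousAt_iff] at hcont
  obtain ⟨δ, hδ, hδε⟩ := hcont ε hε
  have hpos : 0 < min δ (Real.exp u / 2) := lt_min hδ (by positivity)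
  obtain ⟨q, hq1, hq2⟩ := exists_rat_btwn (sub_lt_self (Real.exp u) hpos)
  -- `q` is a positive rational within `δ` of `exp u`
  have hq_pos : (0 : ℝ) < q := by
    have : Real.exp u - min δ (Real.exp u / 2) ≥ Real.exp u - Real.exp u / 2 :=
      sub_le_sub_left (min_le_right _ _) _
    have hexp : 0 < Real.exp u := Real.exp_pos u
    linarith
  have hq_pos' : (0 : ℚ) < q := by exact_mod_cast hq_pos
  have hdist : dist (q : ℝ) (Real.exp u) < δ := by
    rw [Real.dist_eq, abs_sub_lt_iff]
    constructor
    · linarith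
    · linarith [min_le_left δ (Real.exp u / 2)]
  have hlog : dist (Real.log q) (Real.log (Real.exp u)) < ε := hδε hdist
  rw [Real.log_exp] at hlog
  refine ⟨Real.log q, ?_, by rwa [dist_comm] at hlog⟩
  -- `log q = log (num q) − log (den q)`
  have hnum_pos : 0 < q.num := Rat.num_pos.mpr hq_pos'
  refine ⟨q.num.toNat, q.den, ?_, q.den_pos, ?_⟩
  · have : (1 : ℤ) ≤ q.num := hnum_pos
    omega
  · have hcast : (q : ℝ) = (q.num : ℝ) / (q.den : ℝ) := by exact_mod_cast (Rat.num_div_den q).symm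
    have hnum_eq : ((q.num.toNat : ℕ) : ℝ) = (q.num : ℝ) := by
      have h := Int.toNat_of_nonneg hnum_pos.le
      exact_mod_cast h
    rw [hcast, Real.log_div (by exact_mod_cast hnum_pos.ne') (by exact_mod_cast q.den_pos.ne'),
      hnum_eq]

/-- RATIONALS ↦ INTEGERS: non-negativity of the screw forms on log-integer configurations implies
non-negativity on configurations in `log ℚ_{>0}` (translate the augmented zero-sum configuration
by the logarithm of a common denominator). -/
theorem screwForm_nonneg_of_logRat
    (h : ∀ (N : ℕ) (t x : Fin N → ℝ), (∀ i, t i ∈ {u : ℝ | ∃ m : ℕ, 1 ≤ m ∧ u = Real.log m}) →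
      0 ≤ ∑ i, ∑ j, zetaScrewKernel (t i) (t j) * (x i * x j))
    {N : ℕ} (t x : Fin N → ℝ) (ht : ∀ i, t i ∈ {u : ℝ | ∃ m n : ℕ, 1 ≤ m ∧ 1 ≤ n ∧ u = Real.log m - Real.log n}) :
    0 ≤ ∑ i, ∑ j, zetaScrewKernel (t i) (t j) * (x i * x j) := by
  choose m n hm hn hmn using ht
  -- common denominator
  set D : ℕ := ∏ i, n i with hD
  have hDpos : 1 ≤ D := by
    rw [hD]
    exact Nat.one_le_iff_ne_zero.mpr (Finset.prod_ne_zero_iff.mpr fun i _ => by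
      have := hn i; omega)
  rw [screwForm_eq_cons_shift t x (Real.log D)]
  apply h
  intro i
  refine Fin.cases ?_ (fun k => ?_) i
  · exact ⟨D, hDpos, by simp⟩
  · simp only [Fin.cons_succ, Set.mem_setOf_eq]
    have hdvd : n k ∣ D := by
      rw [hD]
      exact Finset.dvd_prod_of_mem n (Finset.mem_univ k)
    obtain ⟨e, he⟩ := hdvd
    have hnk : (n k : ℝ) ≠ 0 := by
      have := hn k
      exact_mod_cast (by omega : n k ≠ 0)
    have hepos : 1 ≤ e := by
      rcases Nat.eq_zero_or_pos e with h0 | h0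
      · rw [h0, mul_zero] at he; omega
      · exact h0
    refine ⟨m k * e, Nat.one_le_iff_ne_zero.mpr (Nat.mul_ne_zero (by have := hm k; omega)
      (by omega)), ?_⟩
    rw [hmn k, he]
    have hmk : (m k : ℝ) ≠ 0 := by
      have := hm k
      exact_mod_cast (by omega : m k ≠ 0)
    have he0 : (e : ℝ) ≠ 0 := by exact_mod_cast (by omega : e ≠ 0)
    push_cast
    rw [Real.log_mul hnk he0, Real.log_mul hmk he0]
    ring

/-- The screw quadratic form is continuous in the configuration. -/
theorem continuous_screwForm {N : ℕ} (x : Fin N → ℝ) :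
    Continuous fun t : Fin N → ℝ => ∑ i, ∑ j, zetaScrewKernel (t i) (t j) * (x i * x j) := by
  refine continuous_finsetSum _ fun i _ => continuous_finsetSum _ fun j _ => ?_
  refine Continuous.mul ?_ continuous_const
  simp only [zetaScrewKernel_def]
  exact ((continuous_zetaScrew.comp (continuous_apply i)).add
    (continuous_zetaScrew.comp (continuous_apply j))).sub
      (continuous_zetaScrew.comp ((continuous_apply i).sub (continuous_apply j)))

end IntegerScrew

open IntegerScrew in
/-- **`ScrewDensityDetection`** (route IntegerScrew, support item stmt-RiemannHypothesis-15760; also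
stub S2 `stub_densityDetection` of the lines of crux `ScrewPolyFloor`): if Suzuki's kernel has
non-negative real quadratic forms on all finite configurations of logarithms of positive integers,
then on all finite real configurations. -/
theorem screwDensityDetection_proof :
    Summit.RiemannHypothesis.RiemannHypothesis.Theses.IntegerScrew.ScrewDensityDetection := by
  intro h N t x
  -- the closed set of configurations with non-negative form contains the dense set of
  -- configurations in `log ℚ_{>0}`
  have hclosed : IsClosed {s : Fin N → ℝ | 0 ≤ ∑ i, ∑ j, zetaScrewKernel (s i) (s j) * (x i * x j)} :=
    isClosed_le continuous_const (continuous_screwForm x)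
  have hdense : Dense (Set.pi Set.univ fun _ : Fin N =>
      {u : ℝ | ∃ m n : ℕ, 1 ≤ m ∧ 1 ≤ n ∧ u = Real.log m - Real.log n}) :=
    dense_pi Set.univ fun _ _ => dense_logRatSet
  have hsub : Set.pi Set.univ (fun _ : Fin N =>
      {u : ℝ | ∃ m n : ℕ, 1 ≤ m ∧ 1 ≤ n ∧ u = Real.log m - Real.log n}) ⊆
      {s : Fin N → ℝ | 0 ≤ ∑ i, ∑ j, zetaScrewKernel (s i) (s j) * (x i * x j)} := by
    intro s hs
    exact screwForm_nonneg_of_logRat h s x fun i => hs i (Set.mem_univ i)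
  have huniv := hdense.closure_eq
  have hmem : t ∈ closure (Set.pi Set.univ fun _ : Fin N =>
      {u : ℝ | ∃ m n : ℕ, 1 ≤ m ∧ 1 ≤ n ∧ u = Real.log m - Real.log n}) := by
    rw [huniv]; exact Set.mem_univ t
  exact closure_minimal hsub hclosed hmem

end Summit.RiemannHypothesis.RiemannHypothesis.Theorems

end
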